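import Mathlib
import Summits.Ventures.PercRepro2.Defs
import Summits.Ventures.PercRepro2.Harris
import Summits.Ventures.PercRepro2.CoinDefs
import Summits.Ventures.PercRepro2.CoinInduced
import Summits.Ventures.PercRepro2.CoinLsmCoreDefs
import Summits.Ventures.PercRepro2.CoinLsmCoreU
import Summits.Ventures.PercRepro2.CoinOrTailKDefs
import Summits.Ventures.PercRepro2.CoinTreeCore
import Summits.Ventures.PercRepro2.CoinKSureTailSums
import Summits.Ventures.PercRepro2.CoinSubdivide
import Summits.Ventures.PercRepro2.CoinKSureSubOrTail
import Summits.Ventures.PercRepro2.CoinKSureSubLsm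
import Summits.Ventures.PercRepro2.CoinKSureSubGen
import Summits.Ventures.PercRepro2.CoinKSureMarkerB
import Summits.Ventures.PercRepro2.CoinKSureMarkerBCoins
import Summits.Ventures.PercRepro2.CoinKSureMarkerAB

/-!
# Both markers at OR-vertices, ARBITRARY coins (blind cell PercRepro2, night-2 g15;
proofs/NIGHT2-DARC.md §55)

§55's sure-coin theorem `darc_of_orTailKSure_markerAB` (markers `(a, b)`) transfers to
arbitrary coins exactly as in §54: subdivide the `b`-coins (`darc_of_orTailK_markerAB_bcoins`),
then the `a`-coins first (`darc_of_orTailK_markerAB_coins`), with the mirror `(b, a)` and the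
out-tree corollary `darc_of_orTailTreeK_markerAB_coins`.
-/

namespace Summit.Ventures.PercRepro2.Coin

open Classical

section MarkerABCoins

variable {V : Type*} {E : Type*} [Fintype V] [DecidableEq V] [Fintype E] [DecidableEq E]
  {R : Type*} [Field R] [LinearOrder R] [IsStrictOrderedRing R]
  {arcs : E → Finset (V × V)} {s : V} {U : Finset V} {ent : Finset V} {c : V → E} {a w : V}
  {entb : Finset V} {d : V → E} {b : V}

/-- **THEOREM (markers `(a, b)`, sure `a`-coins, ARBITRARY `b`-coins).** -/
theorem darc_of_orTailK_markerAB_bcoins (pr : E → R) (hp : IsProbVec pr) (hS : SameEnds arcs)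
    (h : OrTailK arcs s U ent c a) (hb : OrTailK arcs s (insert a U) entb d b) (hae : a ∉ entb)
    (hsure : ∀ r ∈ ent, pr (c r) = 1)
    (hν : ∀ W W', W ⊆ U → W' ⊆ U →
      prob pr (coreLevel arcs s U W) * prob pr (coreLevel arcs s U W') ≤
        prob pr (coreLevel arcs s U (W ∩ W')) * prob pr (coreLevel arcs s U (W ∪ W')))
    {t : V} (htC : t ∉ insert b (insert a U)) (hts : t ≠ s) (hws : w ≠ s)
    (hwC : w ∉ insert b (insert a U)) :
    DARC pr arcs s {t} a b a w := by
  have hba : b ≠ a := fun e => hb.a_notin (e ▸ Finset.mem_insert_self a U)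
  have hbU : b ∉ U := fun hbU => hb.a_notin (Finset.mem_insert_of_mem hbU)
  have hentU : entb ⊆ U := by
    intro r hr
    have := hb.ent_sub hr
    rw [Finset.mem_insert] at this
    rcases this with rfl | h'
    · exact absurd hr hae
    · exact h'
  -- the subdivided coins: the entry coins of `b`
  have hSb := hb.arcs_entry
  have hsrc : ∀ e ∈ entb.image d, srcOf entb d s e ∈ U := fun e he => hentU (hb.srcOf_mem he)
  have htgt : ∀ e ∈ entb.image d, (fun _ => b) e ∉ U := fun _ _ => hbU
  have htgts : ∀ e ∈ entb.image d, (fun _ => b) e ≠ s := fun _ _ => hb.a_ne_s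
  have htgta : ∀ e ∈ entb.image d, (fun _ => b) e ≠ a := fun _ _ => hba
  have hc₀ : ∀ r ∈ ent, c r ∉ entb.image d := by
    intro r hr hmem
    obtain ⟨q, hq, hqr⟩ := Finset.mem_image.1 hmem
    have h1 := h.arcs_c r hr
    have h2 := hb.arcs_c q hq
    rw [hqr] at h2
    rw [h1] at h2
    have : (r, a) ∈ ({(q, b)} : Finset (V × V)) := by rw [← h2]; exact Finset.mem_singleton_self _
    rw [Finset.mem_singleton, Prod.mk.injEq] at this
    exact hba this.2.symm
  have hU : ClosedInCoreU arcs s U := ⟨h.into_U, h.into_s, h.s_notin⟩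
  -- the two OR-tails of the subdivided system
  have h' := orTailK_sub_untouched' (S := entb.image d) (src := srcOf entb d s) (tgt := fun _ => b)
    h hsrc htgts htgta hc₀
  have hb' := orTailK_sub hb
  rw [subCore_insert_left] at hb'
  have hae' : Sum.inl a ∉ (entb.image d).map Function.Embedding.inr := by
    intro hmem
    obtain ⟨e, _, he⟩ := Finset.mem_map.1 hmem
    exact Sum.inr_ne_inl he
  have hsure' : ∀ r ∈ ent.map Function.Embedding.inl,
      subPr pr ((Sum.elim (fun v => Sum.inl (c v)) (fun e => Sum.inr e) : V ⊕ E → E ⊕ E) r) = 1 := by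
    intro r hr
    obtain ⟨r₀, hr₀, rfl⟩ := Finset.mem_map.1 hr
    exact hsure r₀ hr₀
  have hsureb' : ∀ r ∈ (entb.image d).map Function.Embedding.inr,
      subPr pr ((Sum.elim (fun v => Sum.inl (d v)) (fun e => Sum.inr e) : V ⊕ E → E ⊕ E) r) = 1 := by
    intro r hr
    obtain ⟨e, _, rfl⟩ := Finset.mem_map.1 hr
    rfl
  have hν' := subCore_lsm_gen pr hp hU hSb hsrc htgt htgts hν (entb.image d) (Finset.Subset.refl _)
  simp only [subLawS] at hν'
  have htC' : Sum.inl t ∉ insert (Sum.inl b) (insert (Sum.inl a) (subCore U (entb.image d))) := by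
    rw [Finset.mem_insert, Finset.mem_insert, inl_mem_subCore, not_or, not_or]
    rw [Finset.mem_insert, Finset.mem_insert, not_or, not_or] at htC
    exact ⟨fun e => htC.1 (Sum.inl_injective e), fun e => htC.2.1 (Sum.inl_injective e), htC.2.2⟩
  have hwC' : Sum.inl w ∉ insert (Sum.inl b) (insert (Sum.inl a) (subCore U (entb.image d))) := by
    rw [Finset.mem_insert, Finset.mem_insert, inl_mem_subCore, not_or, not_or]
    rw [Finset.mem_insert, Finset.mem_insert, not_or, not_or] at hwC
    exact ⟨fun e => hwC.1 (Sum.inl_injective e), fun e => hwC.2.1 (Sum.inl_injective e), hwC.2.2⟩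
  have key := darc_of_orTailKSure_markerAB (subPr pr) (isProbVec_subPr hp) (sameEnds_sub hS) h' hb'
    hae' hsure' hsureb' (fun W W' hW hW' => hν' W hW W' hW') htC'
    (fun e => hts (Sum.inl_injective e)) (fun e => hws (Sum.inl_injective e)) hwC'
  have hiff := darc_sub_iff hSb pr s {t} a b a w
  rw [Finset.map_singleton] at hiff
  exact hiff.1 key

/-- **THEOREM (markers `(a, b)`, ARBITRARY coins on both OR-vertices).**
`OrTailK arcs s U ent c a` and `OrTailK arcs s (insert a U) entb d b` with any entry sets and
any coin probabilities, `a ∉ entb`, `SameEnds`, the cluster law of `U` log-supermodular, the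
markers `m ∈ U` and `b`, every head: `DARC pr arcs s {t} a b a w`. -/
theorem darc_of_orTailK_markerAB_coins (pr : E → R) (hp : IsProbVec pr) (hS : SameEnds arcs)
    (h : OrTailK arcs s U ent c a) (hb : OrTailK arcs s (insert a U) entb d b) (hae : a ∉ entb)
    (hν : ∀ W W', W ⊆ U → W' ⊆ U →
      prob pr (coreLevel arcs s U W) * prob pr (coreLevel arcs s U W') ≤
        prob pr (coreLevel arcs s U (W ∩ W')) * prob pr (coreLevel arcs s U (W ∪ W')))
    {t : V} (htC : t ∉ insert b (insert a U)) (hts : t ≠ s) (hws : w ≠ s)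
    (hwC : w ∉ insert b (insert a U)) :
    DARC pr arcs s {t} a b a w := by
  have hba : b ≠ a := fun e => hb.a_notin (e ▸ Finset.mem_insert_self a U)
  -- the subdivided coins: the entry coins of `a`
  have hSa := h.arcs_entry
  have h₁ := orTailK_sub h
  have hsrc₁ : ∀ e ∈ ent.image c, srcOf ent c s e ∈ insert a U :=
    fun e he => Finset.mem_insert_of_mem (h.ent_sub (h.srcOf_mem he))
  have htgts₁ : ∀ e ∈ ent.image c, (fun _ => a) e ≠ s := fun _ _ => h.a_ne_s
  have htgtb : ∀ e ∈ ent.image c, (fun _ => a) e ≠ b := fun _ _ => hba.symm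
  have hd₀ : ∀ q ∈ entb, d q ∉ ent.image c := by
    intro q hq hmem
    obtain ⟨r, hr, hrq⟩ := Finset.mem_image.1 hmem
    have h1 := hb.arcs_c q hq
    have h2 := h.arcs_c r hr
    rw [hrq] at h2
    rw [h1] at h2
    have : (q, b) ∈ ({(r, a)} : Finset (V × V)) := by rw [← h2]; exact Finset.mem_singleton_self _
    rw [Finset.mem_singleton, Prod.mk.injEq] at this
    exact hba this.2
  have hb₁ := orTailK_sub_untouched' (S := ent.image c) (src := srcOf ent c s) (tgt := fun _ => a)
    hb hsrc₁ htgts₁ htgtb hd₀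
  rw [subCore_insert_left] at hb₁
  have hae₁ : (Sum.inl a : V ⊕ E) ∉ entb.map (Function.Embedding.inl : V ↪ V ⊕ E) := by
    intro hmem
    obtain ⟨q, hq, hqa⟩ := Finset.mem_map.1 hmem
    have : q = a := Sum.inl_injective hqa
    exact hae (this ▸ hq)
  have hsure₁ : ∀ r ∈ (ent.image c).map Function.Embedding.inr,
      subPr pr ((Sum.elim (fun v => Sum.inl (c v)) (fun e => Sum.inr e) : V ⊕ E → E ⊕ E) r) = 1 := by
    intro r hr
    obtain ⟨e, _, rfl⟩ := Finset.mem_map.1 hr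
    rfl
  have hν₁ := subCore_lsm pr hp h hν (ent.image c) (Finset.Subset.refl _)
  simp only [subLaw] at hν₁
  have htC₁ : Sum.inl t ∉ insert (Sum.inl b) (insert (Sum.inl a) (subCore U (ent.image c))) := by
    rw [Finset.mem_insert, Finset.mem_insert, inl_mem_subCore, not_or, not_or]
    rw [Finset.mem_insert, Finset.mem_insert, not_or, not_or] at htC
    exact ⟨fun e => htC.1 (Sum.inl_injective e), fun e => htC.2.1 (Sum.inl_injective e), htC.2.2⟩
  have hwC₁ : Sum.inl w ∉ insert (Sum.inl b) (insert (Sum.inl a) (subCore U (ent.image c))) := by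
    rw [Finset.mem_insert, Finset.mem_insert, inl_mem_subCore, not_or, not_or]
    rw [Finset.mem_insert, Finset.mem_insert, not_or, not_or] at hwC
    exact ⟨fun e => hwC.1 (Sum.inl_injective e), fun e => hwC.2.1 (Sum.inl_injective e), hwC.2.2⟩
  have key := darc_of_orTailK_markerAB_bcoins (subPr pr) (isProbVec_subPr hp) (sameEnds_sub hS)
    h₁ hb₁ hae₁ hsure₁ (fun W W' hW hW' => hν₁ W hW W' hW') htC₁
    (fun e => hts (Sum.inl_injective e)) (fun e => hws (Sum.inl_injective e)) hwC₁
  have hiff := darc_sub_iff hSa pr s {t} a b a w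
  rw [Finset.map_singleton] at hiff
  exact hiff.1 key

/-- **The mirror: markers `(b, a)`, arbitrary coins.** -/
theorem darc_of_orTailK_markerAB_coins' (pr : E → R) (hp : IsProbVec pr) (hS : SameEnds arcs)
    (h : OrTailK arcs s U ent c a) (hb : OrTailK arcs s (insert a U) entb d b) (hae : a ∉ entb)
    (hν : ∀ W W', W ⊆ U → W' ⊆ U →
      prob pr (coreLevel arcs s U W) * prob pr (coreLevel arcs s U W') ≤
        prob pr (coreLevel arcs s U (W ∩ W')) * prob pr (coreLevel arcs s U (W ∪ W')))
    {t : V} (htC : t ∉ insert b (insert a U)) (hts : t ≠ s) (hws : w ≠ s)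
    (hwC : w ∉ insert b (insert a U)) :
    DARC pr arcs s {t} b a a w :=
  (darc_swap pr arcs s {t} a b a w).1
    (darc_of_orTailK_markerAB_coins pr hp hS h hb hae hν htC hts hws hwC)

/-- **COROLLARY (out-tree core): markers `(a, b)`, arbitrary coins.** -/
theorem darc_of_orTailTreeK_markerAB_coins (pr : E → R) (hp : IsProbVec pr) (hS : SameEnds arcs)
    (h : OrTailK arcs s U ent c a) (hb : OrTailK arcs s (insert a U) entb d b) (hae : a ∉ entb)
    {c' : V → E} {par : V → V} {rk : V → ℕ} (hT : TreeCore arcs s U c' par rk)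
    {t : V} (htC : t ∉ insert b (insert a U)) (hts : t ≠ s) (hws : w ≠ s)
    (hwC : w ∉ insert b (insert a U)) :
    DARC pr arcs s {t} a b a w :=
  darc_of_orTailK_markerAB_coins pr hp hS h hb hae (hT.coreLevel_lsm pr hp) htC hts hws hwC

end MarkerABCoins

end Summit.Ventures.PercRepro2.Coin
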